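import Literature.MathematicalPhysics.KineticTheory.HardSphereBBGKYLiouvilleBoundary
import Literature.Analysis.FluidPDE.BoltzmannGradLimitProofs
import Mathlib.MeasureTheory.Measure.Lebesgue.EqHaar
import HarnessLib

/-!
# Preliminaries for the assembly of the mild BBGKY hierarchy: degenerate geometries,
# antipodal directions, the top marginal, measurability of Lanford data

Ninth file of the proof of `Literature.MathematicalPhysics.KineticTheory.bbgky_hierarchy_of_liouville`
(**hilbert6.S07**; plan in `HardSphereBBGKYLiouvilleFlow`). Small facts used by the final assembly
(`HardSphereBBGKYLiouvilleHolds`) to dispatch the hypotheses of the intermediate-level construction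
(`exists_level_version`, `exists_boundaryData`):

* `measurable_of_continuousOn_of_eq_zero`: a function continuous on a measurable set and vanishing
  off it is measurable (Lanford data are continuous on `D_ε^N` and vanish off it).
* `nthMarginal_self_apply`: the top marginal is the function itself, `f^{(N)} = f`.
* `hardSphereDomain_eq_empty_of_card_eq_zero`, `volume_hardSphereDomain_eq_zero_of_card_eq_one`:
  in the degenerate geometries (`card d = 0`, or `card d = 1` with `ε = 1/2`) two or more hard
  spheres have no room: the hard-sphere domain is empty, resp. Lebesgue-null.
* `sphereMeasure_setOf_reprSym_proj_ne_eq_zero`: the set of directions `ω ∈ S^{d-1}` for which the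
  minimal image of `εω` is not `εω` (`reprSym (proj (εω)) ≠ εω`) is `σ`-null whenever
  `0 ≤ ε < 1/2` (it is empty) or `2 ≤ card d` (it lies on the coordinate axes, whose cones are
  contained in proper subspaces, `Measure.addHaar_submodule`).

Theorems only; no definition and no named fact is introduced.

## References

* I. Gallagher, L. Saint-Raymond, B. Texier, *From Newton to Boltzmann*, EMS (2013),
  arXiv:1208.5753, Ch. 4 intro (minimal image on `T^d`, `ε < 1/2`), (4.3.2).
-/

open MeasureTheory Set Filter Topology Metric Module
open scoped ENNReal InnerProductSpace Pointwise

namespace Literature.MathematicalPhysics.KineticTheory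

open Literature.Analysis.FluidPDE

noncomputable section

variable {d : Type*} [Fintype d]

/-! ## Measurability of Lanford data -/

/-- A function continuous on a measurable set and vanishing off it is measurable. [folklore] -/
theorem measurable_of_continuousOn_of_eq_zero {X : Type*} [TopologicalSpace X] [MeasurableSpace X]
    [OpensMeasurableSpace X] {D : Set X} (hD : MeasurableSet D) {W : X → ℝ} (hWc : ContinuousOn W D)
    (hWD : ∀ z ∉ D, W z = 0) : Measurable W := by
  refine measurable_of_restrict_of_restrict_compl hD ?_ ?_
  · exact (continuousOn_iff_continuous_restrict.1 hWc).measurable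
  · have : Dᶜ.restrict W = fun _ => 0 := by
      funext z; exact hWD z.1 z.2
    rw [this]
    exact measurable_const

/-! ## The top marginal -/

/-- **The top marginal is the function itself**: `nthMarginal N N g = g` (the integral over the
empty block of particles is evaluation). [folklore] -/
theorem nthMarginal_self_apply {X : Type*} [MeasureSpace X] [SigmaFinite (volume : Measure X)]
    {N : ℕ} (g : Config N d X → ℝ) (Z : Config N d X) : nthMarginal N N g Z = g Z := by
  rw [nthMarginal_of_le le_rfl]
  simp only [marginal]
  haveI : IsEmpty (Fin (N - N)) := by rw [Nat.sub_self]; infer_instance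
  have hpi : (volume : Measure (Config (N - N) d X)) = Measure.dirac (isEmptyElim (α := Fin (N - N))) := by
    rw [volume_pi]
    exact Measure.pi_of_empty _ _
  rw [hpi, integral_dirac]
  congr 1
  funext i
  have hi : Fin.cast (Nat.add_sub_of_le (le_rfl : N ≤ N)).symm i = Fin.castAdd (N - N) i := Fin.ext rfl
  rw [hi, Fin.append_left]

/-! ## Degenerate geometries -/

/-- With no spatial dimension (`card d = 0`) every separation vector vanishes, so for `ε > 0` two
or more hard spheres have no admissible configuration: `D_ε^N = ∅` for `N ≥ 2`. [folklore] -/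
theorem hardSphereDomain_eq_empty_of_card_eq_zero {X : Type*} {G : Geometry d X} {ε : ℝ} (hε : 0 < ε)
    (hd : Fintype.card d = 0) {N : ℕ} (hN : 2 ≤ N) : hardSphereDomain G N ε = ∅ := by
  haveI : IsEmpty d := Fintype.card_eq_zero_iff.1 hd
  ext z
  simp only [mem_empty_iff_false, iff_false, mem_hardSphereDomain, not_forall]
  refine ⟨⟨0, by omega⟩, ⟨1, by omega⟩, by simp [Fin.ext_iff], ?_⟩
  have : G.sepVec (z ⟨0, by omega⟩).1 (z ⟨1, by omega⟩).1 = 0 := Subsingleton.elim _ _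
  rw [this, norm_zero, not_le]
  exact hε

/-- On the one-dimensional torus (`card d = 1`) a minimal-image vector has norm at most `1/2`. [folklore] -/
theorem norm_reprSym_le_half_of_card_eq_one (hd : Fintype.card d = 1) (y : UnitAddTorus d) :
    ‖Torus.reprSym y‖ ≤ 1 / 2 := by
  obtain ⟨k₀, hk₀⟩ := Fintype.card_eq_one_iff.1 hd
  rw [EuclideanSpace.norm_eq]
  have huniv : (Finset.univ : Finset d) = {k₀} := by
    ext k; simp [hk₀ k]
  rw [huniv, Finset.sum_singleton, Real.sqrt_sq_eq_abs, Real.norm_eq_abs, abs_abs]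
  have h := Torus.reprSym_apply_mem_Ioc y k₀
  rw [abs_le]
  constructor <;> linarith [h.1, h.2]

/-- **Hard rods of length `1/2` on the unit circle**: for `card d = 1` and `ε = 1/2`, every
admissible configuration of `N ≥ 2` rods has rods `0` and `1` exactly antipodal, so the
hard-sphere domain is Lebesgue-null (`volume_contactSet`). [folklore] -/
theorem volume_hardSphereDomain_eq_zero_of_card_eq_one (hd : Fintype.card d = 1) {N : ℕ} (hN : 2 ≤ N) :
    volume (hardSphereDomain (Torus.geometry d) N (1 / 2)) = 0 := by
  have hsub : hardSphereDomain (Torus.geometry d) N (1 / 2) ⊆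
      contactSet (Torus.geometry d) N (1 / 2) ⟨0, by omega⟩ ⟨1, by omega⟩ := by
    intro z hz
    refine ⟨hz, le_antisymm ?_ ((mem_hardSphereDomain.1 hz) _ _ (by simp [Fin.ext_iff]))⟩
    rw [Torus.geometry_sepVec]
    exact norm_reprSym_le_half_of_card_eq_one hd _
  exact measure_mono_null hsub (volume_contactSet (by norm_num) (by simp [Fin.ext_iff]))

/-! ## Antipodal directions -/

omit [Fintype d] in
/-- The minimal image of `εω` is `εω` as soon as every coordinate of `εω` lies in `(-1/2, 1/2]`. [folklore] -/
theorem reprSym_proj_eq_self {u : EuclideanSpace ℝ d} (hu : ∀ i, u i ∈ Ioc (-(1 / 2 : ℝ)) (1 / 2)) :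
    Torus.reprSym (Literature.Analysis.FunctionSpaces.Torus.proj u) = u := by
  have h := Torus.reprSym_add_proj (x := (0 : UnitAddTorus d)) (s := u) (fun i => by
    rw [Torus.reprSym_zero]; simpa using hu i)
  rwa [zero_add, Torus.reprSym_zero, zero_add] at h

/-- For `0 ≤ ε < 1/2` no direction is antipodal: `reprSym (proj (εω)) = εω` for all unit `ω`. [folklore] -/
theorem reprSym_proj_smul_eq_of_lt {ε : ℝ} (hε0 : 0 ≤ ε) (hε : ε < 1 / 2)
    (ω : sphere (0 : EuclideanSpace ℝ d) 1) :
    Torus.reprSym (Literature.Analysis.FunctionSpaces.Torus.proj (ε • (ω : EuclideanSpace ℝ d))) =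
      ε • (ω : EuclideanSpace ℝ d) := by
  refine reprSym_proj_eq_self fun i => ?_
  have h1 : |(ε • (ω : EuclideanSpace ℝ d)) i| ≤ ‖ε • (ω : EuclideanSpace ℝ d)‖ := by
    simpa using PiLp.norm_apply_le (ε • (ω : EuclideanSpace ℝ d)) i
  rw [norm_smul, Real.norm_eq_abs, abs_of_nonneg hε0, norm_eq_of_mem_sphere, mul_one] at h1
  rw [abs_le] at h1
  constructor <;> linarith [h1.1, h1.2]

/-- A direction whose `ε`-multiple (`0 ≤ ε ≤ 1/2`) is not its own minimal image lies on a
coordinate axis: some coordinate of `ω` is `-1`, and then all the others vanish. [folklore] -/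
theorem exists_axis_of_reprSym_proj_ne {ε : ℝ} (hε0 : 0 ≤ ε) (hε : ε ≤ 1 / 2)
    {ω : sphere (0 : EuclideanSpace ℝ d) 1}
    (h : Torus.reprSym (Literature.Analysis.FunctionSpaces.Torus.proj (ε • (ω : EuclideanSpace ℝ d))) ≠
      ε • (ω : EuclideanSpace ℝ d)) :
    ∃ k : d, ∀ j, j ≠ k → (ω : EuclideanSpace ℝ d) j = 0 := by
  classical
  by_contra hcon
  push Not at hcon
  apply h
  refine reprSym_proj_eq_self fun i => ?_
  have hωi : |(ω : EuclideanSpace ℝ d) i| ≤ 1 := by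
    have := PiLp.norm_apply_le (p := 2) (ω : EuclideanSpace ℝ d) i
    simpa [norm_eq_of_mem_sphere] using this
  have hprod : |(ε • (ω : EuclideanSpace ℝ d)) i| ≤ 1 / 2 := by
    rw [PiLp.smul_apply, smul_eq_mul, abs_mul, abs_of_nonneg hε0]
    nlinarith
  rw [abs_le] at hprod
  refine ⟨lt_of_le_of_ne hprod.1 fun heq => ?_, hprod.2⟩
  -- `ε ω_i = -1/2` forces `ε = 1/2` and `ω_i = -1`, hence the other coordinates vanish
  obtain ⟨j, hji, hj⟩ := hcon i
  have hωi1 : (ω : EuclideanSpace ℝ d) i = -1 := by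
    rw [PiLp.smul_apply, smul_eq_mul] at heq
    rw [abs_le] at hωi
    nlinarith [hωi.1, hωi.2]
  have hnorm : ∑ k, (ω : EuclideanSpace ℝ d) k ^ 2 = 1 := by
    have h1 := norm_eq_of_mem_sphere ω
    rw [EuclideanSpace.norm_eq, Real.sqrt_eq_one] at h1
    simpa using h1
  have hsplit : ∑ k, (ω : EuclideanSpace ℝ d) k ^ 2 =
      (ω : EuclideanSpace ℝ d) i ^ 2 + ∑ k ∈ Finset.univ.erase i, (ω : EuclideanSpace ℝ d) k ^ 2 :=
    (Finset.add_sum_erase _ _ (Finset.mem_univ i)).symm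
  have hj2 : (ω : EuclideanSpace ℝ d) j ^ 2 ≤ ∑ k ∈ Finset.univ.erase i, (ω : EuclideanSpace ℝ d) k ^ 2 :=
    Finset.single_le_sum (f := fun k => (ω : EuclideanSpace ℝ d) k ^ 2) (fun _ _ => sq_nonneg _)
      (Finset.mem_erase.2 ⟨hji, Finset.mem_univ j⟩)
  have : (ω : EuclideanSpace ℝ d) j ^ 2 ≤ 0 := by
    rw [hsplit, hωi1] at hnorm
    nlinarith
  exact hj (pow_eq_zero_iff (n := 2) (by norm_num) |>.1 (le_antisymm this (sq_nonneg _)))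

/-- **Antipodal directions are `σ`-null** for `0 ≤ ε ≤ 1/2` in dimension `≥ 2`: they lie on the
coordinate axes (`exists_axis_of_reprSym_proj_ne`), and the cone over the sphere points of a
coordinate axis is contained in the proper subspace spanned by that axis, which is Lebesgue-null
(`Measure.addHaar_submodule`; `Measure.toSphere_apply'`). [folklore] -/
theorem sphereMeasure_setOf_reprSym_proj_ne_eq_zero {ε : ℝ} (hε0 : 0 ≤ ε) (hε : ε ≤ 1 / 2)
    (hd : 2 ≤ Fintype.card d) :
    sphereMeasure {ω : sphere (0 : EuclideanSpace ℝ d) 1 |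
      Torus.reprSym (Literature.Analysis.FunctionSpaces.Torus.proj (ε • (ω : EuclideanSpace ℝ d))) ≠
        ε • (ω : EuclideanSpace ℝ d)} = 0 := by
  classical
  -- the axes
  have haxis : ∀ k : d, sphereMeasure {ω : sphere (0 : EuclideanSpace ℝ d) 1 |
      ∀ j, j ≠ k → (ω : EuclideanSpace ℝ d) j = 0} = 0 := by
    intro k
    haveI : DecidableEq d := Classical.decEq d
    -- a second coordinate
    have hk' : ∃ k' : d, k' ≠ k := by
      by_contra hall
      push Not at hall
      have : Fintype.card d ≤ 1 := Fintype.card_le_one_iff.2 fun a b => by rw [hall a, hall b]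
      omega
    obtain ⟨k', hk'k⟩ := hk'
    -- the submodule spanned by the axis
    set S : Submodule ℝ (EuclideanSpace ℝ d) := Submodule.span ℝ {EuclideanSpace.single k (1 : ℝ)} with hS
    have hStop : S ≠ ⊤ := by
      intro htop
      have hmem : EuclideanSpace.single k' (1 : ℝ) ∈ S := by rw [htop]; exact Submodule.mem_top
      rw [hS, Submodule.mem_span_singleton] at hmem
      obtain ⟨a, ha⟩ := hmem
      have := congrArg (fun v : EuclideanSpace ℝ d => v k') ha
      simp [hk'k.symm] at this
    have hmeas : MeasurableSet {ω : sphere (0 : EuclideanSpace ℝ d) 1 | ∀ j, j ≠ k → (ω : EuclideanSpace ℝ d) j = 0} := by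
      have : {ω : sphere (0 : EuclideanSpace ℝ d) 1 | ∀ j, j ≠ k → (ω : EuclideanSpace ℝ d) j = 0} =
          ⋂ j ∈ {j : d | j ≠ k}, {ω : sphere (0 : EuclideanSpace ℝ d) 1 | (ω : EuclideanSpace ℝ d) j = 0} := by
        ext ω; simp
      rw [this]
      refine MeasurableSet.biInter (to_countable _) fun j _ => ?_
      have hcoord : Measurable fun v : EuclideanSpace ℝ d => v j :=
        (EuclideanSpace.proj (𝕜 := ℝ) j).continuous.measurable
      exact measurableSet_eq_fun (hcoord.comp measurable_subtype_coe) measurable_const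
    unfold sphereMeasure
    rw [Measure.toSphere_apply' _ hmeas]
    have hcone : Ioo (0 : ℝ) 1 • (((↑) : sphere (0 : EuclideanSpace ℝ d) 1 → EuclideanSpace ℝ d) ''
        {ω : sphere (0 : EuclideanSpace ℝ d) 1 | ∀ j, j ≠ k → (ω : EuclideanSpace ℝ d) j = 0}) ⊆ (S : Set (EuclideanSpace ℝ d)) := by
      rintro _ ⟨r, -, _, ⟨ω, hω, rfl⟩, rfl⟩
      simp only [mem_setOf_eq] at hω
      have hv : (ω : EuclideanSpace ℝ d) = ((ω : EuclideanSpace ℝ d) k) • EuclideanSpace.single k (1 : ℝ) := by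
        ext j
        by_cases hj : j = k
        · subst hj; simp
        · simp [hj, hω j hj]
      show r • (ω : EuclideanSpace ℝ d) ∈ S
      rw [hv, smul_smul, hS]
      exact Submodule.smul_mem _ _ (Submodule.subset_span rfl)
    rw [measure_mono_null hcone (Measure.addHaar_submodule _ S hStop), mul_zero]
  -- the bad set lies on the axes
  refine measure_mono_null (fun ω hω => ?_) ((measure_iUnion_null_iff (μ := sphereMeasure)).2 haxis)
  simp only [mem_setOf_eq] at hω
  obtain ⟨k, hk⟩ := exists_axis_of_reprSym_proj_ne hε0 hε hω
  exact mem_iUnion.2 ⟨k, hk⟩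

/-- **Antipodal directions are `σ`-null** in the two cases met by the hierarchy: `ε < 1/2`
(no such direction) or `2 ≤ card d`. [folklore] -/
theorem sphereMeasure_setOf_reprSym_proj_ne_eq_zero' {ε : ℝ} (hε0 : 0 ≤ ε) (hε : ε ≤ 1 / 2)
    (h : ε < 1 / 2 ∨ 2 ≤ Fintype.card d) :
    sphereMeasure {ω : sphere (0 : EuclideanSpace ℝ d) 1 |
      Torus.reprSym (Literature.Analysis.FunctionSpaces.Torus.proj (ε • (ω : EuclideanSpace ℝ d))) ≠
        ε • (ω : EuclideanSpace ℝ d)} = 0 := by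
  rcases h with h | h
  · have : {ω : sphere (0 : EuclideanSpace ℝ d) 1 |
        Torus.reprSym (Literature.Analysis.FunctionSpaces.Torus.proj (ε • (ω : EuclideanSpace ℝ d))) ≠
          ε • (ω : EuclideanSpace ℝ d)} = ∅ := by
      ext ω
      simp only [mem_setOf_eq, mem_empty_iff_false, iff_false, not_not]
      exact reprSym_proj_smul_eq_of_lt hε0 h ω
    rw [this, measure_empty]
  · exact sphereMeasure_setOf_reprSym_proj_ne_eq_zero hε0 hε h

end

end Literature.MathematicalPhysics.KineticTheory
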